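/-
Copyright (c) 2026 the pub-hodgecm-mathlib formalisation cell (harness21).  Prover seat hodgecm-mathlib-K2E1-p02 (g5), Track B ∕ K2-LIT,
h413 = `stmt-HodgeConjecture-24833`, line `K2_E1_TraceFormulaBeta`, «EIS-RANK-ONE» rung R6d₂ part (a): on `U(J₂)`, `E(f) − E(f)_B` IS the sum of the
non-zero Fourier coefficients of the big-cell function along `N(F)\N(𝔸)` — by POISSON on `F\𝔸_F` (hypothesis-first).  2026-09-04.
-/
import Summits.HodgeConjecture.HodgeConjecture.Theorems.K2E1EisensteinSeriesLeftRight      -- ★ (K2E1-p09 (g4)): CT `borelConstantTerm_eisensteinSeriesU_two` = `f + (ν𝓕)⁻¹ ∫_N f(w₀ v g)`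
import Summits.HodgeConjecture.HodgeConjecture.Theorems.K2E1BorelEisensteinUDefs          -- ★ p857359 (K2E1-p08 (g4)): `eisensteinSeriesU`, big cell `…_eq_apply_add_tsum_unipotent_two`
import Literature.NumberTheory.Automorphic.UnitaryGroupLineUnipotentTwo                 -- ★ the line `middleRootUnipotent : 𝔸_E⁻ ≅ N(𝔸_F)` at `N = 2`
import Literature.NumberTheory.Automorphic.UnitaryGroupTraceZeroLine                    -- ★ `traceZeroLine : 𝔸_F ≃ₜ+ 𝔸_E⁻`, `exists_eq_algebraMap_mul_of_conj_eq_neg`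
import Literature.NumberTheory.Automorphic.AdelicPoissonSummation                       -- ★ Tate 4.2.4 `AdeleRing.tsum_eq_inv_measure_mul_tsum_adeleFourierCoeff`
import HarnessLib

/-!
# h413 ∕ Track B «K2-LIT», «EIS-RANK-ONE» R6d₂ (a) — helper `K2E1EisensteinMinusConstantTermPoissonU2`:
# `E(f)(g) − E(f)_B(g) = μ(D)⁻¹ · Σ_{ξ ∈ F, ξ ≠ 0} Φ̂_g(ξ)` on `U(J₂)`, `Φ_g(t) = f(w₀ · n(tδ) · g)`, by Poisson summation on `F\𝔸_F`

Cell `pub/hodgecm-mathlib`, crux H413 = `stmt-HodgeConjecture-24833`, route `HCCMUnconditional`; DEAL «EIS-R6d₂» of the dealer K2E1-plan (g3)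
2026-09-04T05:01:15Z ∕ priority call 05:02:05Z; REPORT-FIRST 05:04:02Z (three files: (a) Poisson packaging — THIS FILE; (b) Siegel-set reduction + bound under the
Fourier-side smoothness binder; (c) the binder for `K`-finite flat sections).  THEOREMS ONLY (no `def`, no `instance`, no `notation`, no named-fact hypothesis, no
`sorry`); lane `--kind proof --supports stmt-HodgeConjecture-24833 --as helper` (count-neutral); campaign SPEC `K2/K2E1-plan/g3/SPEC-EIS-R6-MaassSelberg` §2 R6d.

THE MECHANISM (Mœglin–Waldspurger II.1.7 with I.2.6; Garrett (2018) §2.8–§2.9).  On `G = U(J₂)` the Borel Eisenstein series of a left-`B(F)`-invariant `f` is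
`E(f)(g) = f(g) + Σ_{n ∈ N(F)} f(w₀ n g)` (★ `eisensteinSeriesU_eq_apply_add_tsum_unipotent_two`, the two Bruhat cells) and its constant term along `B` is
`E(f)_B(g) = f(g) + (ν𝓕)⁻¹ ∫_{N(𝔸)} f(w₀ v g) dν(v)` (★ `borelConstantTerm_eisensteinSeriesU_two`).  The unipotent radical is the LINE: `t ↦ n(tδ)`,
`𝔸_F ≅ 𝔸_E⁻ ≅ N(𝔸_F)` (★ `traceZeroLine`, ★ `middleRootUnipotent`), carrying `F` onto `N(F)` (§2).  Hence with `Φ_g(t) := f(w₀ · n(tδ) · g)`: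
`E(f)(g) − E(f)_B(g) = Σ_{ξ ∈ F} Φ_g(ξ) − μ(D)⁻¹ ∫_{𝔸_F} Φ_g dμ = μ(D)⁻¹ Σ_{ξ ≠ 0} Φ̂_g(ξ)` by POISSON (★ Tate 4.2.4, `Φ̂_g(0) = ∫ Φ_g`), `D` Tate's
fundamental domain of `F\𝔸_F`, `Φ̂ = adeleFourierCoeff μ` — provided the big-cell integral is normalised as `(ν𝓕)⁻¹ ∫_{N(𝔸)} = μ(D)⁻¹ ∫_{𝔸_F}` along the chart
(the hypothesis `hnorm`: covolume bookkeeping of the two Haar measures, discharged in the sequel for every Haar `ν` and every fundamental domain `𝓕`).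

* §1 (any number field `K`) `adeleFourierCoeff_zero` (`F̂(0) = ∫ F`); **`tsum_sub_inv_measure_mul_integral_eq_tsum_indicator`** — Poisson repackaged:
  `Σ_{ξ∈K} F(ξ) − μ(D)⁻¹∫F = μ(D)⁻¹ Σ_ξ 𝟙_{ξ≠0} F̂(ξ)`, and the bound `‖…‖ ≤ μ(D)⁻¹ Σ_ξ 𝟙_{ξ≠0}‖F̂(ξ)‖`.
* §2 (`U(J₂)`, `E/F` CM-type quadratic with `cδ = −δ ≠ 0`) `toAdelic_unipotent_eq_chart` (the rational unipotent `n_E(ξδ)` goes to the chart point `n((ξ)_𝔸 δ)`),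
  **`tsum_unipotentU_two_eq_tsum`** — `Σ_{n ∈ N(F)} T(n_𝔸) = Σ_{ξ ∈ F} T(n(ξδ))` for ANY `T` (re-indexing along the bijection `F ≅ N(F)`, `ξ ↦ n_E(ξδ)`; Mathlib
  `Equiv.tsum_eq` with `Equiv.ofBijective`).
* §3 **`eisensteinSeriesU_sub_borelConstantTerm_eq_two`** (THE HEAD, hypothesis-first): under the hypotheses of the two ★ lemmas, the four Poisson hypotheses ON
  `Φ_g` (continuity, integrability, locally uniform summable majorant of translates, `Σ‖Φ̂_g(ξ)‖ < ∞` — Godement ∕ the (G)-twin and file (c) discharge them) and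
  `hnorm`:  `E(f)(g) − E(f)_B(g) = μ(D)⁻¹ · Σ_ξ 𝟙_{ξ≠0} Φ̂_g(ξ)`;  **`norm_eisensteinSeriesU_sub_borelConstantTerm_le_two`** — `‖E(f)(g) − E(f)_B(g)‖ ≤
  μ(D)⁻¹ Σ_ξ 𝟙_{ξ≠0} ‖Φ̂_g(ξ)‖` (what file (b) scales along the torus and R6e consumes as boundedness).

HONEST LABEL.  Count-neutral helper; proves no printed statement; HC_CM is proved only modulo the 7 printed citations (2 remaining named inputs: hLiu418 =
`stmt-HodgeConjecture-24832`, h413 = `stmt-HodgeConjecture-24833`) until rung 0 closes.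

## References
* [MoeglinWaldspurger1995] C. Mœglin, J.-L. Waldspurger, *Spectral decomposition and Eisenstein series* (1995), I.2.6 (constant terms), II.1.7.
* [Garrett2018] P. Garrett, *Modern Analysis of Automorphic Forms by Example*, vol. 1 (2018), §2.8–§2.9 (`E − E_P` via Poisson, rapid decay).
* [CasselsFrohlichANT1967] J. W. S. Cassels, A. Fröhlich (eds.), *Algebraic Number Theory* (1967), Ch. XV (Tate) Lemma 4.2.4 (adelic Poisson summation).
-/

set_option autoImplicit false
set_option linter.dupNamespace false  -- the mandated namespace repeats the summit's segment (`HodgeConjecture.HodgeConjecture`)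

noncomputable section

open scoped Matrix
open MeasureTheory NumberField IsDedekindDomain MulAction
open Literature.NumberTheory.Automorphic Literature.NumberTheory.Automorphic.UnitaryGroup
open Summit.HodgeConjecture.HodgeConjecture.Cruxes.H413.K2E1BorelEisensteinU
open Summit.HodgeConjecture.HodgeConjecture.Cruxes.H413.K2E1EisensteinSeriesLeftRight

namespace Summit.HodgeConjecture.HodgeConjecture.Cruxes.H413.K2E1EisensteinMinusConstantTermPoissonU2

/-! ## §1 Poisson summation repackaged: `Σ_ξ F(ξ) − μ(D)⁻¹ ∫ F = μ(D)⁻¹ Σ_{ξ ≠ 0} F̂(ξ)` -/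

section Poisson

variable (K : Type) [Field K] [NumberField K]

/-- `F̂(0) = ∫ F dμ` (the character is trivial at `ξ = 0`). [cite: CasselsFrohlichANT1967, Ch. XV Lemma 4.2.4] -/
theorem adeleFourierCoeff_zero [MeasurableSpace (AdeleRing (𝓞 K) K)] (μ : Measure (AdeleRing (𝓞 K) K)) (F : AdeleRing (𝓞 K) K → ℂ) :
    adeleFourierCoeff μ F 0 = ∫ x, F x ∂μ := by
  simp only [adeleFourierCoeff_apply, map_zero, zero_mul, AddChar.map_zero_eq_one, Circle.coe_one, mul_one]

/-- **Poisson summation, repackaged**: for `F : 𝔸_K → ℂ` continuous, integrable, with locally uniform summable majorants of its `K`-translates and summable Fourier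
coefficients, `Σ_{ξ ∈ K} F(ξ) − μ(D)⁻¹ ∫ F dμ = μ(D)⁻¹ Σ_{ξ ∈ K} 𝟙_{ξ ≠ 0} F̂(ξ)` (★ Tate 4.2.4 and `F̂(0) = ∫ F`). [cite: CasselsFrohlichANT1967, Ch. XV Lemma 4.2.4] -/
theorem tsum_sub_inv_measure_mul_integral_eq_tsum_indicator [MeasurableSpace (AdeleRing (𝓞 K) K)] [BorelSpace (AdeleRing (𝓞 K) K)]
    (μ : Measure (AdeleRing (𝓞 K) K)) [μ.IsAddHaarMeasure] {F : AdeleRing (𝓞 K) K → ℂ} (hF : Continuous F) (hFi : Integrable F μ)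
    (hloc : ∀ C : Set (AdeleRing (𝓞 K) K), IsCompact C → ∃ u : K → ℝ, Summable u ∧
      ∀ x ∈ C, ∀ ξ : K, ‖F (x + algebraMap K (AdeleRing (𝓞 K) K) ξ)‖ ≤ u ξ)
    (hsum : Summable fun ξ : K => ‖adeleFourierCoeff μ F ξ‖) :
    ∑' ξ : K, F (algebraMap K (AdeleRing (𝓞 K) K) ξ) - ((μ (adeleFundamentalDomain K)).toReal⁻¹ : ℂ) * ∫ x, F x ∂μ =
      ((μ (adeleFundamentalDomain K)).toReal⁻¹ : ℂ) * ∑' ξ : K, ({0}ᶜ : Set K).indicator (adeleFourierCoeff μ F) ξ := by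
  classical
  rw [AdeleRing.tsum_eq_inv_measure_mul_tsum_adeleFourierCoeff K μ hF hFi hloc hsum, (Summable.of_norm hsum).tsum_eq_add_tsum_ite 0,
    adeleFourierCoeff_zero]
  have hite : (fun ξ : K => ite (ξ = 0) 0 (adeleFourierCoeff μ F ξ)) = ({0}ᶜ : Set K).indicator (adeleFourierCoeff μ F) := by
    funext ξ
    by_cases hξ : ξ = 0
    · rw [if_pos hξ, Set.indicator_of_notMem (by rw [hξ, Set.mem_compl_iff, Set.mem_singleton_iff, not_not])]
    · rw [if_neg hξ, Set.indicator_of_mem (by rwa [Set.mem_compl_iff, Set.mem_singleton_iff])]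
  rw [hite]
  push_cast
  ring

/-- The bound form: `‖Σ_{ξ ∈ K} F(ξ) − μ(D)⁻¹ ∫ F dμ‖ ≤ μ(D)⁻¹ Σ_{ξ ∈ K} 𝟙_{ξ ≠ 0} ‖F̂(ξ)‖`. [cite: CasselsFrohlichANT1967, Ch. XV Lemma 4.2.4] -/
theorem norm_tsum_sub_inv_measure_mul_integral_le [MeasurableSpace (AdeleRing (𝓞 K) K)] [BorelSpace (AdeleRing (𝓞 K) K)]
    (μ : Measure (AdeleRing (𝓞 K) K)) [μ.IsAddHaarMeasure] {F : AdeleRing (𝓞 K) K → ℂ} (hF : Continuous F) (hFi : Integrable F μ)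
    (hloc : ∀ C : Set (AdeleRing (𝓞 K) K), IsCompact C → ∃ u : K → ℝ, Summable u ∧
      ∀ x ∈ C, ∀ ξ : K, ‖F (x + algebraMap K (AdeleRing (𝓞 K) K) ξ)‖ ≤ u ξ)
    (hsum : Summable fun ξ : K => ‖adeleFourierCoeff μ F ξ‖) :
    ‖∑' ξ : K, F (algebraMap K (AdeleRing (𝓞 K) K) ξ) - ((μ (adeleFundamentalDomain K)).toReal⁻¹ : ℂ) * ∫ x, F x ∂μ‖ ≤
      (μ (adeleFundamentalDomain K)).toReal⁻¹ * ∑' ξ : K, ({0}ᶜ : Set K).indicator (fun ξ => ‖adeleFourierCoeff μ F ξ‖) ξ := by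
  rw [tsum_sub_inv_measure_mul_integral_eq_tsum_indicator K μ hF hFi hloc hsum, norm_mul, norm_inv, Complex.norm_real,
    Real.norm_of_nonneg ENNReal.toReal_nonneg]
  refine mul_le_mul_of_nonneg_left ?_ (inv_nonneg.2 ENNReal.toReal_nonneg)
  have hs : Summable fun ξ : K => ({0}ᶜ : Set K).indicator (fun ξ => ‖adeleFourierCoeff μ F ξ‖) ξ := hsum.indicator _
  refine (norm_tsum_le_tsum_norm ?_).trans (le_of_eq (tsum_congr fun ξ => ?_))
  · refine hs.of_nonneg_of_le (fun _ => norm_nonneg _) fun ξ => ?_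
    rw [norm_indicator_eq_indicator_norm]
  · rw [norm_indicator_eq_indicator_norm]

end Poisson

/-! ## §2 `U(J₂)`: the rational unipotent radical `N(F)` is the line `ξ ↦ n(ξδ)` -/

section Line

variable {F E : Type} [Field F] [NumberField F] [Field E] [NumberField E] [Algebra F E] [Algebra.IsQuadraticExtension F E] {c : E ≃ₐ[F] E}
  (hij : (((0 : Fin 2) : ℕ)) + 1 = ((1 : Fin 2) : ℕ)) (hN : 2 = 2 * ((0 : Fin 2) : ℕ) + 2) {δ : E}

omit [NumberField F] [NumberField E] [Algebra.IsQuadraticExtension F E] in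
/-- **The unipotent `n_E(b) = (1 b; 0 1)` with `b = ξδ`, `ξ ∈ F`, lies in `N(F) ≤ U(J₂)(F)`** (trace zero: `b + c b = 0`); packaged as the existence of the element of
★ `unipotentU` with that matrix. [cite: Rogawski1990, §1.10] -/
theorem exists_unipotentU_two_coe_eq (hcδ : c δ = -δ) (ξ : F) :
    ∃ n : ↥(unipotentU (c : E →+* E) ((StdForm.antidiagonal 2).over E)),
      (((n : ↥(unitaryGroupOfForm (c : E →+* E) ((StdForm.antidiagonal 2).over E))) : GL (Fin 2) E) : Matrix (Fin 2) (Fin 2) E) =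
        !![1, algebraMap F E ξ * δ; 0, 1] := by
  have hmul : !![(1 : E), algebraMap F E ξ * δ; 0, 1] * !![1, -(algebraMap F E ξ * δ); 0, 1] = 1 := by
    ext i j; fin_cases i <;> fin_cases j <;> simp [Matrix.mul_apply, Fin.sum_univ_two]
  have hmul' : !![(1 : E), -(algebraMap F E ξ * δ); 0, 1] * !![1, algebraMap F E ξ * δ; 0, 1] = 1 := by
    ext i j; fin_cases i <;> fin_cases j <;> simp [Matrix.mul_apply, Fin.sum_univ_two]
  have hU : (⟨_, _, hmul, hmul'⟩ : GL (Fin 2) E) ∈ unitaryGroupOfForm (c : E →+* E) ((StdForm.antidiagonal 2).over E) := by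
    rw [mem_unitaryGroupOfForm_iff, ← antidiagOne_eq_over (L := E) (N := 2)]
    ext i j
    fin_cases i <;> fin_cases j <;>
      simp [Matrix.mul_apply, Fin.sum_univ_two, Matrix.map_apply, Matrix.of_apply, hcδ]
  refine ⟨⟨⟨_, hU⟩, (mem_unipotentU_iff _).2 ⟨?_, ?_⟩⟩, rfl⟩
  · intro i j hij'
    fin_cases i <;> fin_cases j <;> simp_all
  · intro i
    fin_cases i <;> rfl

/-- **Every element of `N(F) ≤ U(J₂)(F)` is an `n_E(ξδ)`, `ξ ∈ F`**: an upper unitriangular `(1 b; 0 1) ∈ U(J₂)(E)` has `b + c b = 0` (the `(1,1)` entry of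
`(c n)ᵀ J₂ n = J₂`), so `b = ξδ` (★ `exists_eq_algebraMap_mul_of_conj_eq_neg`). [cite: Rogawski1990, §1.10] -/
theorem exists_coe_eq_of_mem_unipotentU_two (hcδ : c δ = -δ) (hδ : δ ≠ 0) (n : ↥(unipotentU (c : E →+* E) ((StdForm.antidiagonal 2).over E))) :
    ∃ ξ : F, (((n : ↥(unitaryGroupOfForm (c : E →+* E) ((StdForm.antidiagonal 2).over E))) : GL (Fin 2) E) : Matrix (Fin 2) (Fin 2) E) =
      !![1, algebraMap F E ξ * δ; 0, 1] := by
  obtain ⟨htri, hdiag⟩ := (mem_unipotentU_iff _).1 n.2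
  have h10 : (((n : ↥(unitaryGroupOfForm (c : E →+* E) ((StdForm.antidiagonal 2).over E))) : GL (Fin 2) E) : Matrix (Fin 2) (Fin 2) E) 1 0 = 0 :=
    htri (show (id (0 : Fin 2)) < id 1 by decide)
  have h00 := hdiag 0
  have h11 := hdiag 1
  -- the `(1,1)` entry of the unitarity relation: `c b · 1 + 1 · b = 0`
  have hunit := (n : ↥(unitaryGroupOfForm (c : E →+* E) ((StdForm.antidiagonal 2).over E))).2
  rw [mem_unitaryGroupOfForm_iff] at hunit
  have hJ : ∀ i j : Fin 2, (StdForm.antidiagonal 2).over E i j = if i.val + j.val + 1 = 2 then (1 : E) else 0 := fun i j => by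
    rw [← antidiagOne_eq_over (L := E) (N := 2)]; rfl
  have h := congrFun (congrFun hunit 1) 1
  simp only [Matrix.mul_apply, Fin.sum_univ_two, Matrix.transpose_apply, Matrix.map_apply, hJ, h11, map_one, Fin.val_zero, Fin.val_one] at h
  norm_num at h
  -- `h : c b + b = 0`
  have hcb : c ((((n : ↥(unitaryGroupOfForm (c : E →+* E) ((StdForm.antidiagonal 2).over E))) : GL (Fin 2) E) : Matrix (Fin 2) (Fin 2) E) 0 1) =
      -((((n : ↥(unitaryGroupOfForm (c : E →+* E) ((StdForm.antidiagonal 2).over E))) : GL (Fin 2) E) : Matrix (Fin 2) (Fin 2) E) 0 1) := by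
    linear_combination h
  obtain ⟨ξ, hξ⟩ := exists_eq_algebraMap_mul_of_conj_eq_neg E c hcδ hδ hcb
  refine ⟨ξ, ?_⟩
  ext i j
  fin_cases i <;> fin_cases j
  · exact h00
  · exact hξ
  · exact h10
  · exact h11

/-- **The rational unipotent goes to the chart point**: `(n_E(ξδ))_𝔸 = n((ξ)_𝔸 · δ)` in `U(J₂)(𝔸_F)` — ★ `toAdelic` of the element of `exists_unipotentU_two_coe_eq` is
★ `middleRootUnipotent (traceZeroLine ξ)`. [cite: Rogawski1990, §1.10] -/
theorem toAdelic_eq_chart_of_coe_eq (hcδ : c δ = -δ) (hδ : δ ≠ 0) {n : ↥(unipotentU (c : E →+* E) ((StdForm.antidiagonal 2).over E))} {ξ : F}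
    (hn : (((n : ↥(unitaryGroupOfForm (c : E →+* E) ((StdForm.antidiagonal 2).over E))) : GL (Fin 2) E) : Matrix (Fin 2) (Fin 2) E) =
      !![1, algebraMap F E ξ * δ; 0, 1]) :
    (quasiSplit F E c 2).toAdelic (n : ↥(unitaryGroupOfForm (c : E →+* E) ((StdForm.antidiagonal 2).over E))) =
      ((middleRootUnipotent hij hN (Multiplicative.ofAdd (traceZeroLine F E c hcδ hδ (algebraMap F (AdeleRing (𝓞 F) F) ξ))) :
        ↥(adelicUnipotent F E c 2)) : (quasiSplit F E c 2).Adelic) := by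
  apply Subtype.ext
  apply Units.ext
  have key : ((((n : ↥(unitaryGroupOfForm (c : E →+* E) ((StdForm.antidiagonal 2).over E))) : GL (Fin 2) E) : Matrix (Fin 2) (Fin 2) E)).map
        (algebraMap E (AdeleRing (𝓞 E) E)) =
      1 + Matrix.single (0 : Fin 2) (1 : Fin 2)
        (((traceZeroLine F E c hcδ hδ (algebraMap F (AdeleRing (𝓞 F) F) ξ) : traceZeroAdele F E c) : AdeleRing (𝓞 E) E)) := by
    rw [hn, coe_traceZeroLine, AdeleRing.baseChange_algebraMap, ← map_mul]
    ext i j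
    fin_cases i <;> fin_cases j <;> simp [Matrix.single]
  exact key

/-- **RE-INDEXING THE BIG CELL ALONG THE LINE**: `Σ'_{n ∈ N(F)} T(n_𝔸) = Σ'_{ξ ∈ F} T(n((ξ)_𝔸 δ))` for every `T : U(J₂)(𝔸_F) → ℂ` — `ξ ↦ n_E(ξδ)` is a bijection
`F ≅ N(F)` (Mathlib `Equiv.ofBijective`, `Equiv.tsum_eq`). [cite: Rogawski1990, §1.10] -/
theorem tsum_unipotentU_two_eq_tsum (hcδ : c δ = -δ) (hδ : δ ≠ 0) (T : (quasiSplit F E c 2).Adelic → ℂ) :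
    ∑' n : ↥(unipotentU (c : E →+* E) ((StdForm.antidiagonal 2).over E)),
        T ((quasiSplit F E c 2).toAdelic (n : ↥(unitaryGroupOfForm (c : E →+* E) ((StdForm.antidiagonal 2).over E)))) =
      ∑' ξ : F, T ((middleRootUnipotent hij hN (Multiplicative.ofAdd (traceZeroLine F E c hcδ hδ (algebraMap F (AdeleRing (𝓞 F) F) ξ))) :
        ↥(adelicUnipotent F E c 2)) : (quasiSplit F E c 2).Adelic) := by
  classical
  choose φ hφ using fun ξ : F => exists_unipotentU_two_coe_eq (E := E) (c := c) hcδ ξ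
  have hinj : Function.Injective φ := by
    intro ξ ξ' h
    have h01 := congrFun (congrFun (congrArg (fun n : ↥(unipotentU (c : E →+* E) ((StdForm.antidiagonal 2).over E)) =>
      (((n : ↥(unitaryGroupOfForm (c : E →+* E) ((StdForm.antidiagonal 2).over E))) : GL (Fin 2) E) : Matrix (Fin 2) (Fin 2) E)) h) 0) 1
    have h01' : algebraMap F E ξ * δ = algebraMap F E ξ' * δ := by simpa [hφ] using h01
    exact (algebraMap F E).injective (mul_right_cancel₀ hδ h01')
  have hsurj : Function.Surjective φ := by
    intro n
    obtain ⟨ξ, hξ⟩ := exists_coe_eq_of_mem_unipotentU_two hcδ hδ n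
    refine ⟨ξ, Subtype.ext (Subtype.ext (Units.ext ?_))⟩
    rw [hφ, hξ]
  rw [← (Equiv.ofBijective φ ⟨hinj, hsurj⟩).tsum_eq]
  exact tsum_congr fun ξ => congrArg T (toAdelic_eq_chart_of_coe_eq hij hN hcδ hδ (hφ ξ))

/-! ## §3 `E(f) − E(f)_B` on `U(J₂)` is the sum of the non-zero Fourier coefficients of the big-cell function -/

/-- **`E(f)(g) − E(f)_B(g) = μ(D)⁻¹ · Σ_{ξ ≠ 0} Φ̂_g(ξ)` ON `U(J₂)`** (hypothesis-first).  Data: `f` left-`N(𝔸)`- and left-`B(F)`-invariant and measurable, `νN` a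
left- and inversion-invariant measure on `N(𝔸_F)` with a fundamental domain `𝓕` of `N(F)` of measure `∉ {0, ∞}`, Godement's majorant `hfin` and the summability
`hs` of the series at `g` (★ CT lemma, ★ big cell), an additive Haar measure `μ` on `𝔸_F`, and the BIG-CELL FUNCTION ALONG THE LINE `Φ = Φ_g`,
`Φ(t) = f(w₀ · n(tδ) · g)` (`hΦ`), subject to Poisson's hypotheses (`hΦc`, `hΦi`, `hloc`, `hsum`) and to the normalisation `hnorm`
`(ν𝓕)⁻¹ ∫_{N(𝔸)} f(w₀ v g) dν = μ(D)⁻¹ ∫_{𝔸_F} Φ dμ` (covolume bookkeeping along the chart; sequel).  Then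
`eisensteinSeriesU f g − borelConstantTerm νN 𝓕 (eisensteinSeriesU f) g = μ(D)⁻¹ · Σ'_ξ 𝟙_{ξ≠0} Φ̂(ξ)`, `D` Tate's domain of `F\𝔸_F`.
[cite: MoeglinWaldspurger1995, II.1.7] [cite: Garrett2018, §2.8] [cite: CasselsFrohlichANT1967, Ch. XV Lemma 4.2.4] -/
theorem eisensteinSeriesU_sub_borelConstantTerm_eq_two (hcδ : c δ = -δ) (hδ : δ ≠ 0)
    [MeasurableSpace (quasiSplit F E c 2).Adelic] [BorelSpace (quasiSplit F E c 2).Adelic]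
    (νN : Measure ↥(adelicUnipotent F E c 2)) [νN.IsMulLeftInvariant] [νN.IsInvInvariant]
    {f : (quasiSplit F E c 2).Adelic → ℂ} (hfm : Measurable f)
    (hfN : ∀ (n : ↥(adelicUnipotent F E c 2)) (y : (quasiSplit F E c 2).Adelic), f ((n : (quasiSplit F E c 2).Adelic) * y) = f y)
    (hfB : ∀ b ∈ borelU (c : E →+* E) ((StdForm.antidiagonal 2).over E), ∀ x : (quasiSplit F E c 2).Adelic, f ((quasiSplit F E c 2).toAdelic b * x) = f x)
    {𝓕 : Set ↥(adelicUnipotent F E c 2)} (h𝓕 : IsFundamentalDomain ↥(rationalUnipotent F E c 2) 𝓕 νN) (h𝓕₀ : νN 𝓕 ≠ 0) (h𝓕top : νN 𝓕 ≠ ⊤)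
    (g : (quasiSplit F E c 2).Adelic)
    (hfin : ∫⁻ u in 𝓕, (∑' q : (quasiSplit F E c 2).quotientSubgroup ⧸ (borelAdelic F E c 2).subgroupOf (quasiSplit F E c 2).quotientSubgroup,
        ‖f ((((q.out : (quasiSplit F E c 2).quotientSubgroup) : (quasiSplit F E c 2).Adelic))⁻¹ * (u : (quasiSplit F E c 2).Adelic) * g)‖ₑ) ∂νN < ⊤)
    (hs : Summable fun q : Quotient (orbitRel ↥(borelU (c : E →+* E) ((StdForm.antidiagonal 2).over E)) ↥(unitaryGroupOfForm (c : E →+* E) ((StdForm.antidiagonal 2).over E))) =>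
      f ((quasiSplit F E c 2).toAdelic (Quotient.out q : ↥(unitaryGroupOfForm (c : E →+* E) ((StdForm.antidiagonal 2).over E))) * g))
    [MeasurableSpace (AdeleRing (𝓞 F) F)] [BorelSpace (AdeleRing (𝓞 F) F)] (μ : Measure (AdeleRing (𝓞 F) F)) [μ.IsAddHaarMeasure]
    {Φ : AdeleRing (𝓞 F) F → ℂ} (hΦ : ∀ t, Φ t = f (((quasiSplit F E c 2).toAdelic (weylLongU (c : E →+* E) (rfl : ((StdForm.antidiagonal 2).over E) = ((StdForm.antidiagonal 2).over E)))) * ((middleRootUnipotent hij hN (Multiplicative.ofAdd (traceZeroLine F E c hcδ hδ t)) : ↥(adelicUnipotent F E c 2)) : (quasiSplit F E c 2).Adelic) * g))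
    (hΦc : Continuous Φ) (hΦi : Integrable Φ μ)
    (hloc : ∀ C : Set (AdeleRing (𝓞 F) F), IsCompact C → ∃ u : F → ℝ, Summable u ∧
      ∀ x ∈ C, ∀ ξ : F, ‖Φ (x + algebraMap F (AdeleRing (𝓞 F) F) ξ)‖ ≤ u ξ)
    (hsum : Summable fun ξ : F => ‖adeleFourierCoeff μ Φ ξ‖)
    (hnorm : ((νN 𝓕).toReal⁻¹ : ℝ) • ∫ v : ↥(adelicUnipotent F E c 2), f (((quasiSplit F E c 2).toAdelic (weylLongU (c : E →+* E) (rfl : ((StdForm.antidiagonal 2).over E) = ((StdForm.antidiagonal 2).over E)))) * (v : (quasiSplit F E c 2).Adelic) * g) ∂νN =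
      ((μ (adeleFundamentalDomain F)).toReal⁻¹ : ℂ) * ∫ t, Φ t ∂μ) :
    eisensteinSeriesU f g - borelConstantTerm νN 𝓕 (eisensteinSeriesU f) g =
      ((μ (adeleFundamentalDomain F)).toReal⁻¹ : ℂ) * ∑' ξ : F, ({0}ᶜ : Set F).indicator (adeleFourierCoeff μ Φ) ξ := by
  have hCT := borelConstantTerm_eisensteinSeriesU_two νN hfm hfN hfB h𝓕 h𝓕₀ h𝓕top g hfin
  have hE := eisensteinSeriesU_eq_apply_add_tsum_unipotent_two (F := F) (E := E) (c := c) (rfl : ((StdForm.antidiagonal 2).over E) = ((StdForm.antidiagonal 2).over E)) hfB hs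
  have hre : ∑' n : ↥(unipotentU (c : E →+* E) ((StdForm.antidiagonal 2).over E)),
      f ((quasiSplit F E c 2).toAdelic (weylLongU (c : E →+* E) (rfl : ((StdForm.antidiagonal 2).over E) = ((StdForm.antidiagonal 2).over E)) * (n : ↥(unitaryGroupOfForm (c : E →+* E) ((StdForm.antidiagonal 2).over E)))) * g) =
        ∑' ξ : F, Φ (algebraMap F (AdeleRing (𝓞 F) F) ξ) := by
    have hmul : ∀ n : ↥(unipotentU (c : E →+* E) ((StdForm.antidiagonal 2).over E)),
        (quasiSplit F E c 2).toAdelic (weylLongU (c : E →+* E) (rfl : ((StdForm.antidiagonal 2).over E) = ((StdForm.antidiagonal 2).over E)) * (n : ↥(unitaryGroupOfForm (c : E →+* E) ((StdForm.antidiagonal 2).over E)))) =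
          ((quasiSplit F E c 2).toAdelic (weylLongU (c : E →+* E) (rfl : ((StdForm.antidiagonal 2).over E) = ((StdForm.antidiagonal 2).over E)))) * (quasiSplit F E c 2).toAdelic (n : ↥(unitaryGroupOfForm (c : E →+* E) ((StdForm.antidiagonal 2).over E))) := fun n => map_mul _ _ _
    have h := tsum_unipotentU_two_eq_tsum hij hN hcδ hδ (fun x => f (((quasiSplit F E c 2).toAdelic (weylLongU (c : E →+* E) (rfl : ((StdForm.antidiagonal 2).over E) = ((StdForm.antidiagonal 2).over E)))) * x * g))
    simp only [hmul]
    simpa only [hΦ] using h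
  rw [hCT, hE, hnorm, hre, add_sub_add_left_eq_sub]
  exact tsum_sub_inv_measure_mul_integral_eq_tsum_indicator F μ hΦc hΦi hloc hsum

/-- **`‖E(f)(g) − E(f)_B(g)‖ ≤ μ(D)⁻¹ · Σ_{ξ ≠ 0} ‖Φ̂_g(ξ)‖` ON `U(J₂)`** — the form file (b) scales along the torus on Siegel sets and R6e consumes as boundedness.
[cite: MoeglinWaldspurger1995, II.1.7] [cite: Garrett2018, §2.9] -/
theorem norm_eisensteinSeriesU_sub_borelConstantTerm_le_two (hcδ : c δ = -δ) (hδ : δ ≠ 0)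
    [MeasurableSpace (quasiSplit F E c 2).Adelic] [BorelSpace (quasiSplit F E c 2).Adelic]
    (νN : Measure ↥(adelicUnipotent F E c 2)) [νN.IsMulLeftInvariant] [νN.IsInvInvariant]
    {f : (quasiSplit F E c 2).Adelic → ℂ} (hfm : Measurable f)
    (hfN : ∀ (n : ↥(adelicUnipotent F E c 2)) (y : (quasiSplit F E c 2).Adelic), f ((n : (quasiSplit F E c 2).Adelic) * y) = f y)
    (hfB : ∀ b ∈ borelU (c : E →+* E) ((StdForm.antidiagonal 2).over E), ∀ x : (quasiSplit F E c 2).Adelic, f ((quasiSplit F E c 2).toAdelic b * x) = f x)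
    {𝓕 : Set ↥(adelicUnipotent F E c 2)} (h𝓕 : IsFundamentalDomain ↥(rationalUnipotent F E c 2) 𝓕 νN) (h𝓕₀ : νN 𝓕 ≠ 0) (h𝓕top : νN 𝓕 ≠ ⊤)
    (g : (quasiSplit F E c 2).Adelic)
    (hfin : ∫⁻ u in 𝓕, (∑' q : (quasiSplit F E c 2).quotientSubgroup ⧸ (borelAdelic F E c 2).subgroupOf (quasiSplit F E c 2).quotientSubgroup,
        ‖f ((((q.out : (quasiSplit F E c 2).quotientSubgroup) : (quasiSplit F E c 2).Adelic))⁻¹ * (u : (quasiSplit F E c 2).Adelic) * g)‖ₑ) ∂νN < ⊤)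
    (hs : Summable fun q : Quotient (orbitRel ↥(borelU (c : E →+* E) ((StdForm.antidiagonal 2).over E)) ↥(unitaryGroupOfForm (c : E →+* E) ((StdForm.antidiagonal 2).over E))) =>
      f ((quasiSplit F E c 2).toAdelic (Quotient.out q : ↥(unitaryGroupOfForm (c : E →+* E) ((StdForm.antidiagonal 2).over E))) * g))
    [MeasurableSpace (AdeleRing (𝓞 F) F)] [BorelSpace (AdeleRing (𝓞 F) F)] (μ : Measure (AdeleRing (𝓞 F) F)) [μ.IsAddHaarMeasure]
    {Φ : AdeleRing (𝓞 F) F → ℂ} (hΦ : ∀ t, Φ t = f (((quasiSplit F E c 2).toAdelic (weylLongU (c : E →+* E) (rfl : ((StdForm.antidiagonal 2).over E) = ((StdForm.antidiagonal 2).over E)))) * ((middleRootUnipotent hij hN (Multiplicative.ofAdd (traceZeroLine F E c hcδ hδ t)) : ↥(adelicUnipotent F E c 2)) : (quasiSplit F E c 2).Adelic) * g))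
    (hΦc : Continuous Φ) (hΦi : Integrable Φ μ)
    (hloc : ∀ C : Set (AdeleRing (𝓞 F) F), IsCompact C → ∃ u : F → ℝ, Summable u ∧
      ∀ x ∈ C, ∀ ξ : F, ‖Φ (x + algebraMap F (AdeleRing (𝓞 F) F) ξ)‖ ≤ u ξ)
    (hsum : Summable fun ξ : F => ‖adeleFourierCoeff μ Φ ξ‖)
    (hnorm : ((νN 𝓕).toReal⁻¹ : ℝ) • ∫ v : ↥(adelicUnipotent F E c 2), f (((quasiSplit F E c 2).toAdelic (weylLongU (c : E →+* E) (rfl : ((StdForm.antidiagonal 2).over E) = ((StdForm.antidiagonal 2).over E)))) * (v : (quasiSplit F E c 2).Adelic) * g) ∂νN =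
      ((μ (adeleFundamentalDomain F)).toReal⁻¹ : ℂ) * ∫ t, Φ t ∂μ) :
    ‖eisensteinSeriesU f g - borelConstantTerm νN 𝓕 (eisensteinSeriesU f) g‖ ≤
      (μ (adeleFundamentalDomain F)).toReal⁻¹ * ∑' ξ : F, ({0}ᶜ : Set F).indicator (fun ξ => ‖adeleFourierCoeff μ Φ ξ‖) ξ := by
  rw [eisensteinSeriesU_sub_borelConstantTerm_eq_two hij hN hcδ hδ νN hfm hfN hfB h𝓕 h𝓕₀ h𝓕top g hfin hs μ hΦ hΦc hΦi hloc hsum hnorm,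
    ← tsum_sub_inv_measure_mul_integral_eq_tsum_indicator F μ hΦc hΦi hloc hsum]
  exact norm_tsum_sub_inv_measure_mul_integral_le F μ hΦc hΦi hloc hsum

end Line

end Summit.HodgeConjecture.HodgeConjecture.Cruxes.H413.K2E1EisensteinMinusConstantTermPoissonU2

end
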